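import Literature.Probability.LatticeModels.WeightedTreeBound
import HarnessLib

/-!
# Aizenman's tree diagram bound for edge-dependent couplings, II: correlation form

Topic `Literature/Probability/LatticeModels`. From the current-sum inequality
`Current.treeBound_currentSum` and the random-current identity `Current.ursellFour_currentSum_identity`
(both in `ℝ≥0∞`) to real correlation ratios `⟨σ_A⟩ = Z_K[A]/Z_K[∅]` (`wcurrentSum`), and then to the
free Gibbs state of a general ferromagnetic **pair interaction** `J ≥ 0` on a finite set at inverse
temperature `β ≥ 0` (Boltzmann weight `exp((β/2)∑_{a,b} J_{a,b}σ_aσ_b)`, i.e. `-βH` for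
`H = -∑_{{a,b}} J_{a,b}σ_aσ_b` with symmetric `J`), through the Ising dictionary
`sum_spinProduct_mul_prod_exp_eq` on the complete graph with couplings `pairEdgeWeight J β`:

* `abs_ursell_ratio_le` — `|U₄| ≤ 2∑_u ∏ᵢ ⟨σ_{xᵢ}σ_u⟩` for the ratios `Z_K[·]/Z_K[∅]`, any `K ≥ 0`;
* `sum_sum_eq_sum_diag_add_sum_edgeFinset_top` — `∑_{a,b} f(a,b) = ∑_a f(a,a) + ∑_{{a,b}} (f(a,b)+f(b,a))`;
* `exp_pair_sum_eq_mul_prod` — `exp((β/2)∑_{a,b}J_{a,b}σ_aσ_b) = exp((β/2)∑_a J_{a,a}) ∏_e exp(K_e σ_e)`;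
* `pairGibbs_spinProduct_eq_wcurrentSum_div` — `⟨σ_A⟩ = Z_K[A]/Z_K[∅]` for that state;
* `abs_ursellFour_pairGibbs_le` — **the tree diagram bound for finite-volume ferromagnetic pair
  interactions** (Aizenman 1982; Panis 2023, §4.2: `|U₄^β(x,y,z,t)| ≤ 2∑_u ⟨σ_xσ_u⟩⟨σ_yσ_u⟩⟨σ_zσ_u⟩⟨σ_tσ_u⟩`,
  "the proof is valid on any graph and thus remains valid in the case of general interactions").

## References

* M. Aizenman, Comm. Math. Phys. 86 (1982) [Aizenman1982]; R. Panis, arXiv:2309.05797 (2023), §4.1–4.2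
  [Panis2023Triviality] (held; read pp. 19–20).
-/

noncomputable section

open Finset Filter
open scoped symmDiff ENNReal

namespace Literature.Probability.LatticeModels

variable {V : Type*} [Fintype V] [DecidableEq V]

/-! ### The bound for the ratios `Z_K[A]/Z_K[∅]` -/

section Ratios

variable {G : SimpleGraph V} [DecidableRel G.Adj] {K : G.edgeFinset → ℝ}

/-- **Tree diagram bound for random-current correlation ratios**: for `K ≥ 0` on a finite graph and
`⟨σ_A⟩ := Z_K[A]/Z_K[∅]`,
`|⟨σ_xσ_yσ_zσ_t⟩ - ⟨σ_xσ_y⟩⟨σ_zσ_t⟩ - ⟨σ_xσ_z⟩⟨σ_yσ_t⟩ - ⟨σ_xσ_t⟩⟨σ_yσ_z⟩| ≤ 2∑_u ⟨σ_xσ_u⟩⟨σ_yσ_u⟩⟨σ_zσ_u⟩⟨σ_tσ_u⟩`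
(`⟨σ_xσ_yσ_zσ_t⟩ = ⟨σ_{{x}Δ{y}Δ{z}Δ{t}}⟩`, `⟨σ_aσ_b⟩ = ⟨σ_{{a}Δ{b}}⟩`).
[cite: Panis2023Triviality, §4.2 (tree diagram bound, display after Proposition 4.7)] -/
theorem abs_ursell_ratio_le (hK : ∀ e, 0 ≤ K e) (x y z t : V) :
    |wcurrentSum K ({x} ∆ ({y} ∆ ({z} ∆ {t}))) / wcurrentSum K ∅ -
        wcurrentSum K ({x} ∆ {y}) / wcurrentSum K ∅ * (wcurrentSum K ({z} ∆ {t}) / wcurrentSum K ∅) -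
        wcurrentSum K ({x} ∆ {z}) / wcurrentSum K ∅ * (wcurrentSum K ({y} ∆ {t}) / wcurrentSum K ∅) -
        wcurrentSum K ({x} ∆ {t}) / wcurrentSum K ∅ * (wcurrentSum K ({y} ∆ {z}) / wcurrentSum K ∅)| ≤
      2 * ∑ u, wcurrentSum K ({x} ∆ {u}) / wcurrentSum K ∅ * (wcurrentSum K ({y} ∆ {u}) / wcurrentSum K ∅) *
        (wcurrentSum K ({z} ∆ {u}) / wcurrentSum K ∅) * (wcurrentSum K ({t} ∆ {u}) / wcurrentSum K ∅) := by
  set W : Finset V → ℝ := fun A => wcurrentSum K A with hW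
  have hW' : ∀ A, (ecurrentSum K A).toReal = W A := fun A => toReal_ecurrentSum hK A
  have hW0 : 0 < W ∅ := wcurrentSum_empty_pos hK
  have hWnn : ∀ A, 0 ≤ W A := fun A => wcurrentSum_nonneg hK A
  have hZtop : ∀ A, ecurrentSum K A ≠ ∞ := fun A => ecurrentSum_ne_top hK A
  -- the intersection term `P` and its finiteness
  set Pe : ℝ≥0∞ := ∑' p : Current G × Current G,
    epairWeight K ({x} ∆ {y}) ({z} ∆ {t}) p * (if z ∈ (p.1 + p.2).cluster x then 1 else 0) with hPe
  have hPle : Pe ≤ ecurrentSum K ({x} ∆ {y}) * ecurrentSum K ({z} ∆ {t}) := by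
    rw [← tsum_epairWeight]
    refine ENNReal.tsum_le_tsum fun p => ?_
    calc epairWeight K ({x} ∆ {y}) ({z} ∆ {t}) p * (if z ∈ (p.1 + p.2).cluster x then 1 else 0)
        ≤ epairWeight K ({x} ∆ {y}) ({z} ∆ {t}) p * 1 := mul_le_mul' le_rfl (by split_ifs <;> simp)
      _ = _ := mul_one _
  have hPtop : Pe ≠ ∞ := ne_top_of_le_ne_top (ENNReal.mul_ne_top (hZtop _) (hZtop _)) hPle
  set p : ℝ := Pe.toReal with hp
  have hp0 : 0 ≤ p := ENNReal.toReal_nonneg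
  -- the identity in `ℝ`
  have hid := congrArg ENNReal.toReal (Current.ursellFour_currentSum_identity hK x y z t)
  rw [ENNReal.toReal_add (ENNReal.add_ne_top.2 ⟨ENNReal.mul_ne_top (hZtop _) (hZtop _),
      ENNReal.mul_ne_top (hZtop _) (hZtop _)⟩) (ENNReal.mul_ne_top (hZtop _) (hZtop _)),
    ENNReal.toReal_add (ENNReal.mul_ne_top (hZtop _) (hZtop _)) (ENNReal.mul_ne_top (hZtop _) (hZtop _)),
    ENNReal.toReal_add (ENNReal.mul_ne_top (hZtop _) (hZtop _)) (ENNReal.mul_ne_top (by simp) hPtop)] at hid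
  simp only [ENNReal.toReal_mul, ENNReal.toReal_ofNat, hW'] at hid
  -- the bound in `ℝ`
  have hbd := ENNReal.toReal_mono (by
      refine ENNReal.sum_ne_top.2 fun u _ => ?_
      exact ENNReal.mul_ne_top (ENNReal.mul_ne_top (hZtop _) (hZtop _)) (ENNReal.mul_ne_top (hZtop _) (hZtop _)))
    (Current.treeBound_currentSum hK x y z t)
  rw [ENNReal.toReal_mul, ENNReal.toReal_pow, ENNReal.toReal_sum (fun u _ =>
    ENNReal.mul_ne_top (ENNReal.mul_ne_top (hZtop _) (hZtop _)) (ENNReal.mul_ne_top (hZtop _) (hZtop _)))] at hbd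
  simp only [ENNReal.toReal_mul, hW'] at hbd
  -- `hid : Wxy Wzt + Wxz Wyt + Wxt Wyz = WD W∅ + 2 p`, `hbd : p W∅² ≤ ∑ Wxu Wyu (Wzu Wtu)`
  change |W _ / W ∅ - W _ / W ∅ * (W _ / W ∅) - W _ / W ∅ * (W _ / W ∅) - W _ / W ∅ * (W _ / W ∅)| ≤
    2 * ∑ u, W _ / W ∅ * (W _ / W ∅) * (W _ / W ∅) * (W _ / W ∅)
  have hL : W ({x} ∆ ({y} ∆ ({z} ∆ {t}))) / W ∅ - W ({x} ∆ {y}) / W ∅ * (W ({z} ∆ {t}) / W ∅) -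
      W ({x} ∆ {z}) / W ∅ * (W ({y} ∆ {t}) / W ∅) - W ({x} ∆ {t}) / W ∅ * (W ({y} ∆ {z}) / W ∅) =
      -(2 * (p * W ∅ ^ 2) / W ∅ ^ 4) := by
    field_simp
    rw [← hp] at hid
    nlinarith [hid]
  have hR : ∑ u, W ({x} ∆ {u}) / W ∅ * (W ({y} ∆ {u}) / W ∅) * (W ({z} ∆ {u}) / W ∅) * (W ({t} ∆ {u}) / W ∅) =
      (∑ u, W ({x} ∆ {u}) * W ({y} ∆ {u}) * (W ({z} ∆ {u}) * W ({t} ∆ {u}))) / W ∅ ^ 4 := by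
    rw [Finset.sum_div]
    refine Finset.sum_congr rfl fun u _ => ?_
    field_simp
  rw [hL, hR, abs_neg, abs_of_nonneg (by positivity), mul_div_assoc]
  refine mul_le_mul_of_nonneg_left (div_le_div_of_nonneg_right ?_ (by positivity)) (by norm_num)
  rw [← hp] at hbd
  exact hbd

end Ratios

/-! ### Pair interactions on a finite set: the dictionary to the complete graph -/

section PairInteraction

omit [DecidableEq V] in
/-- **Ordered double sums as sums over unordered pairs**: for a finite type,
`∑_a ∑_b f(a,b) = ∑_a f(a,a) + ∑_{e ∈ E(K_V)} (f(a,b) + f(b,a))` (`e = {a,b}`, `a ≠ b`). [folklore] -/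
theorem sum_sum_eq_sum_diag_add_sum_edgeFinset_top [DecidableEq V] (f : V → V → ℝ) :
    ∑ a, ∑ b, f a b = ∑ a, f a a +
      ∑ e ∈ (⊤ : SimpleGraph V).edgeFinset, Sym2.lift ⟨fun a b => f a b + f b a, fun _ _ => add_comm _ _⟩ e := by
  rw [← Fintype.sum_prod_type']
  rw [← Finset.sum_filter_add_sum_filter_not univ (fun q : V × V => q.1 = q.2) (fun q : V × V => f q.1 q.2)]
  congr 1
  · -- the diagonal
    refine Finset.sum_bij' (fun q _ => q.1) (fun a _ => (a, a)) (fun q hq => Finset.mem_univ _)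
      (fun a _ => Finset.mem_filter.2 ⟨Finset.mem_univ _, rfl⟩) (fun q hq => ?_) (fun a _ => rfl) (fun q hq => ?_)
    · obtain ⟨a, b⟩ := q
      have h : a = b := (Finset.mem_filter.1 hq).2
      subst h; rfl
    · obtain ⟨a, b⟩ := q
      have h : a = b := (Finset.mem_filter.1 hq).2
      subst h; rfl
  · -- the off-diagonal pairs, grouped by the unordered pair they define
    symm
    rw [← Finset.sum_fiberwise_of_maps_to (s := univ.filter fun q : V × V => ¬ q.1 = q.2)
      (t := (⊤ : SimpleGraph V).edgeFinset) (g := fun q => s(q.1, q.2)) (fun q hq => by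
        rw [SimpleGraph.mem_edgeFinset, SimpleGraph.mem_edgeSet, SimpleGraph.top_adj]
        exact (Finset.mem_filter.1 hq).2)]
    refine Finset.sum_congr rfl fun e he => ?_
    induction e using Sym2.ind with
    | _ a b =>
      have hab : a ≠ b := by
        rw [SimpleGraph.mem_edgeFinset, SimpleGraph.mem_edgeSet, SimpleGraph.top_adj] at he
        exact he
      have hfib : (univ.filter fun q : V × V => ¬ q.1 = q.2).filter (fun q => s(q.1, q.2) = s(a, b)) =
          {(a, b), (b, a)} := by
        ext q
        obtain ⟨c, e⟩ := q
        simp only [Finset.mem_filter, Finset.mem_univ, true_and, Finset.mem_insert, Finset.mem_singleton,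
          Prod.mk.injEq, Sym2.eq_iff]
        constructor
        · rintro ⟨_, ⟨rfl, rfl⟩ | ⟨rfl, rfl⟩⟩
          · exact Or.inl ⟨rfl, rfl⟩
          · exact Or.inr ⟨rfl, rfl⟩
        · rintro (⟨rfl, rfl⟩ | ⟨rfl, rfl⟩)
          · exact ⟨hab, Or.inl ⟨rfl, rfl⟩⟩
          · exact ⟨hab.symm, Or.inr ⟨rfl, rfl⟩⟩
      rw [hfib, Finset.sum_pair (fun h => hab (Prod.mk.inj h).1)]
      rfl

/-- **Factorisation of the pair-interaction Boltzmann weight over the edges of the complete graph**: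
`exp((β/2) ∑_{a,b} J_{a,b} σ_aσ_b) = exp((β/2)∑_a J_{a,a}) · ∏_{e ∈ E(K_V)} exp(K_e σ_e)` with
`K = pairEdgeWeight J β` (`K_{{a,b}} = β(J_{a,b}+J_{b,a})/2`, `σ_a² = 1`). [cite: Panis2023Triviality, §4.1] -/
theorem exp_pair_sum_eq_mul_prod (J : V → V → ℝ) (β : ℝ) (σ : SpinConfig V) :
    Real.exp (β / 2 * ∑ a, ∑ b, J a b * spinAt a σ * spinAt b σ) =
      Real.exp (β / 2 * ∑ a, J a a) *
        ∏ e : (⊤ : SimpleGraph V).edgeFinset, Real.exp (pairEdgeWeight J β e * bondSpin σ (e : Sym2 V)) := by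
  rw [sum_sum_eq_sum_diag_add_sum_edgeFinset_top (fun a b => J a b * spinAt a σ * spinAt b σ)]
  have hdiag : ∑ a, J a a * spinAt a σ * spinAt a σ = ∑ a, J a a :=
    Finset.sum_congr rfl fun a _ => by rw [mul_assoc, spinAt_mul_self, mul_one]
  rw [hdiag, mul_add, Real.exp_add]
  congr 1
  rw [Finset.mul_sum, ← Finset.sum_coe_sort ((⊤ : SimpleGraph V).edgeFinset), Real.exp_sum]
  refine Finset.prod_congr rfl fun e _ => ?_
  congr 1
  obtain ⟨e, he⟩ := e
  induction e using Sym2.ind with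
  | _ a b =>
    rw [pairEdgeWeight_apply_mk, bondSpin_mk]
    change β / 2 * (J a b * spinAt a σ * spinAt b σ + J b a * spinAt b σ * spinAt a σ) = _
    ring

/-- **The free pair-interaction state as random-current ratios** (Panis 2023, §4.1:
`⟨σ_A⟩_{Λ,β} = ∑_{∂n=A}w_β(n)/∑_{∂n=∅}w_β(n)`): for `β ≥ 0`, `J ≥ 0` and every `A`,
`(∑_σ σ_A e^{(β/2)∑J σσ}) / (∑_σ e^{(β/2)∑Jσσ}) = Z_K[A]/Z_K[∅]`, `K = pairEdgeWeight J β`.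
[cite: Panis2023Triviality, §4.1] -/
theorem pairGibbs_spinProduct_eq_wcurrentSum_div {J : V → V → ℝ} {β : ℝ} (hβ : 0 ≤ β) (hJ : ∀ a b, 0 ≤ J a b)
    (A : Finset V) :
    (∑ σ : SpinConfig V, spinProduct A σ * Real.exp (β / 2 * ∑ a, ∑ b, J a b * spinAt a σ * spinAt b σ)) /
        (∑ σ : SpinConfig V, Real.exp (β / 2 * ∑ a, ∑ b, J a b * spinAt a σ * spinAt b σ)) =
      wcurrentSum (pairEdgeWeight J β) A / wcurrentSum (pairEdgeWeight J β) ∅ := by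
  have hK : ∀ e, 0 ≤ pairEdgeWeight J β e := pairEdgeWeight_nonneg hβ hJ
  have hg := exp_pair_sum_eq_mul_prod J β
  have hnum : ∑ σ : SpinConfig V, spinProduct A σ * Real.exp (β / 2 * ∑ a, ∑ b, J a b * spinAt a σ * spinAt b σ) =
      Real.exp (β / 2 * ∑ a, J a a) * ((2 : ℝ) ^ Fintype.card V * wcurrentSum (pairEdgeWeight J β) A) := by
    rw [← sum_spinProduct_mul_prod_exp_eq hK A, Finset.mul_sum]
    exact Finset.sum_congr rfl fun σ _ => by rw [hg σ]; ring
  have hden : ∑ σ : SpinConfig V, Real.exp (β / 2 * ∑ a, ∑ b, J a b * spinAt a σ * spinAt b σ) =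
      Real.exp (β / 2 * ∑ a, J a a) * ((2 : ℝ) ^ Fintype.card V * wcurrentSum (pairEdgeWeight J β) ∅) := by
    rw [← sum_spinProduct_mul_prod_exp_eq hK ∅, Finset.mul_sum]
    exact Finset.sum_congr rfl fun σ _ => by rw [hg σ]; simp [spinProduct]
  rw [hnum, hden, mul_div_mul_left _ _ (Real.exp_pos _).ne', mul_div_mul_left _ _ (by positivity)]

/-- **Aizenman's tree diagram bound for finite-volume ferromagnetic pair interactions** (Aizenman 1982;
Panis 2023, §4.2, display following Proposition 4.7, "the proof is valid on any graph and thus remains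
valid in the case of general interactions"): for a finite set `V`, couplings `J ≥ 0`, `β ≥ 0`, and the
free state `⟨F⟩ = ∑_σ F(σ)e^{(β/2)∑_{a,b}J_{a,b}σ_aσ_b} / ∑_σ e^{(β/2)∑J σσ}`,
`|⟨σ_xσ_yσ_zσ_t⟩ - ⟨σ_xσ_y⟩⟨σ_zσ_t⟩ - ⟨σ_xσ_z⟩⟨σ_yσ_t⟩ - ⟨σ_xσ_t⟩⟨σ_yσ_z⟩| ≤ 2∑_u ⟨σ_xσ_u⟩⟨σ_yσ_u⟩⟨σ_zσ_u⟩⟨σ_tσ_u⟩`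
(spin products written as `σ_{{a}Δ{b}}`, `σ_{{x}Δ{y}Δ{z}Δ{t}}`, so coincident points are allowed).
[cite: Panis2023Triviality, §4.2 (tree diagram bound, display after Proposition 4.7)] -/
theorem abs_ursellFour_pairGibbs_le {J : V → V → ℝ} {β : ℝ} (hβ : 0 ≤ β) (hJ : ∀ a b, 0 ≤ J a b)
    (x y z t : V) :
    let g : SpinConfig V → ℝ := fun σ => Real.exp (β / 2 * ∑ a, ∑ b, J a b * spinAt a σ * spinAt b σ)
    let E : Finset V → ℝ := fun A => (∑ σ, spinProduct A σ * g σ) / ∑ σ, g σ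
    |E ({x} ∆ ({y} ∆ ({z} ∆ {t}))) - E ({x} ∆ {y}) * E ({z} ∆ {t}) - E ({x} ∆ {z}) * E ({y} ∆ {t}) -
        E ({x} ∆ {t}) * E ({y} ∆ {z})| ≤
      2 * ∑ u, E ({x} ∆ {u}) * E ({y} ∆ {u}) * E ({z} ∆ {u}) * E ({t} ∆ {u}) := by
  intro g E
  have hE : ∀ A, E A = wcurrentSum (pairEdgeWeight J β) A / wcurrentSum (pairEdgeWeight J β) ∅ := fun A =>
    pairGibbs_spinProduct_eq_wcurrentSum_div hβ hJ A
  simp only [hE]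
  exact abs_ursell_ratio_le (pairEdgeWeight_nonneg hβ hJ) x y z t

end PairInteraction

end Literature.Probability.LatticeModels

end
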